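import Mathlib.FieldTheory.Galois.Basic
import Literature.NumberTheory.LocalFields.AutFixingValuationUnits
import Literature.AnabelianGeometry.EtaleTheta.LogDivisorModelConstantField

/-!
# [EtTh] §3 p.72 / Prop. 3.4 (ii) / Thm. 3.7 (iii): the constant field of a universal combinatorial covering
# as a structure on the Def. 3.1 interface, and the Galois-correspondence law as a THEOREM

S. Mochizuki, *The étale theta function …*, Publ. RIMS **45** (2009) [MochizukiEtTh2009], §3: p.72 ("the
natural surjection `Π^tp_X ↠ G_K` determines a natural functor `D₀ → D^cnst`"), Def. 3.1 (ii) p.70 (the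
constant log-meromorphic functions "arising from `L^×`"; the integral ones from `O_L^▷`), Def. 3.3 (ii) p.73
("`Z^log → X^log` … finite étale Galois covering … over the ring of integers of the extension field of `K`
determined by the integral closure of `K` in `Z^log`"), Prop. 3.4 (ii) p.74 ("`O_L^× ⥲ Ker(B₀(Y^log) →
Φ₀(Y^log)^gp)`, … `L^× ⥲ F₀(Y^log)`"), Thm. 3.7 (iii) p.79 l.−6 – p.80 l.2 ("the natural action of `Aut_C(A)`
on `O^▷(A)` and `O^×(A)` factors through `Aut_{D^cnst}(A^cnst)` … faithful") [cite: MochizukiEtTh2009, Prop 3.4 p.74].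

CLASS (b) STRUCTURE + THEOREMS (abc-iut cell, W6 seat d058 lineage; the frozen interface `LogDivisorModel` and
the landed `GaloisAction` / `constInertia` / `ConstGaloisLaw` are consumed BY NAME, nothing edited).  GAP row
G-w6d058-2 records that the Galois-correspondence binder `GaloisAction.ConstGaloisLaw A` ("an element of
`G = Gal(Z^log_∞/X^log)` fixing every `H`-invariant unit integral constant lies in `N·H`") is a property of the
GEOMETRIC constant field that the bare interface (`const`, `intConst` as submonoids of `Fn` with a `G`-action)
cannot see, and names as permanent fix "a «constant field» structure carrying the valued field `(L', v)` with
`L'^× = const`, `O^▷ = intConst`, after which the law is a theorem of Mathlib Galois theory".  This file types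
that structure NON-INVASIVELY, as a record over a Galois action `A : Z.GaloisAction G`:

* `GaloisAction.ConstField A K L Γ₀` — the constant field `L` of `Z^log_∞` as a finite extension of the base
  field `K` with a valuation `v`, the surjection `res : G ↠ Aut(L/K)` (`Gal(Z^log_∞/X^log) ↠ Gal(L/K)`), and
  the identification `emb : L^× ↪ Fn` of `L^×` with the constants `const`, under which `O_L^▷ = {v ≤ 1}`
  corresponds to `intConst` and the `G`-action on `Fn` restricts to the Galois action on `L^×`;
* `ConstField.mem_constInertia_iff` / **`constInertia_eq_ker`** — `N := Ker(G → Aut(L^×)) = Ker(res)`;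
* **`ConstField.constGaloisLaw : A.ConstGaloisLaw`** — the binder of G-w6d058-2 is a THEOREM at every datum
  carrying a constant field.  Proof = print's two ingredients: (1) an automorphism of `L/K` fixing the units
  `O_F^×` of the valuation ring of an intermediate field `F` fixes `F` (the units generate `F`:
  `Literature.NumberTheory.LocalFields.ringHom_eq_of_eqOn_valuation_eq_one`, abc-iut-L6-t8 — Thm. 3.7 (iii)
  "faithful on `O^×`"); (2) the Galois correspondence `Fix(L^{H'}) = H'` for the finite extension `L/K`
  (Mathlib `IntermediateField.fixingSubgroup_fixedField`);
* `ConstField.valuation_le_one_iff_of_res` — consequence recorded for the reader: the valuation ring of `L`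
  is stable under `Aut(L/K)` (as it must be for the unique extension of the valuation of `K`);
* NON-VACUITY with a NON-TRIVIAL Galois action: `LogDivisorModel.constOnly L` (the degenerate log-divisor
  model with empty special fibre whose functions are the constants `L^×` of a field with finite unit group —
  Prop. 3.2 (iii) from finiteness), `constOnlyAction K L` (`Aut(L/K)` acting on it), and
  `ConstField.ofConstOnly` (trivial valuation, `res = id`): e.g. `𝔽_4/𝔽_2` with its Frobenius; hence
  `constGaloisLaw_constOnlyAction` — the law with CONTENT (`N = 1`: it is the Galois correspondence itself).
HONEST FRAMING: a structure over typed interfaces and classical Galois theory; print's `L/K` is moreover Galois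
(`Z^log/X^log` Galois, `X` geometrically connected over `K`) and `K/ℚ_p` finite — neither is needed for the law
and neither is recorded; nothing here bears on [IUTchIII] Cor. 3.12; no side taken; typed ≠ proved.
-/

namespace Literature.AnabelianGeometry.EtaleTheta

open CategoryTheory

universe u v w

namespace LogDivisorModel.GaloisAction

variable {Z : LogDivisorModel.{u}} {G : Type u} [Group G] (A : Z.GaloisAction G)

/-- **The constant field of `Z^log_∞`** (class (b) structure over a Galois action on the Def. 3.1 interface):
a finite field extension `L/K` (print: `K` the base field of `X^log`, `L` "the extension field of `K` determined
by the integral closure of `K` in `Z^log`", Def. 3.3 (ii)) with a valuation `v` on `L`, the surjection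
`res : G = Gal(Z^log_∞/X^log) ↠ Aut(L/K)` through which `G` acts on the constants, and the identification
`emb` of `L^×` with the constant log-meromorphic functions `const ⊆ Fn` ("arising from `L^×`", Def. 3.1 (ii)),
matching `O_L^▷ = {x | v x ≤ 1}` with `intConst` and intertwining the two actions.
[cite: MochizukiEtTh2009, Def 3.3 p.73] -/
structure ConstField (K L : Type v) [Field K] [Field L] [Algebra K L] (Γ₀ : Type w)
    [LinearOrderedCommGroupWithZero Γ₀] where
  /-- the valuation of the constant field `L` -/
  v : Valuation L Γ₀
  /-- `L/K` is a finite extension -/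
  finiteDimensional : FiniteDimensional K L
  /-- `Gal(Z^log_∞/X^log) → Aut(L/K)`: the action of `G` on the constant field -/
  res : G →* (L ≃ₐ[K] L)
  /-- … is surjective (`Z^log_∞ → X^log` dominates the constant-field extension) -/
  res_surjective : Function.Surjective res
  /-- `L^× → Fn`: the constant log-meromorphic functions "arising from `L^×`" -/
  emb : Lˣ →* Z.Fn
  /-- … is injective -/
  emb_injective : Function.Injective emb
  /-- … with image exactly the constants `const` -/
  range_emb : emb.range = Z.const
  /-- under `emb`, the integral constants `intConst = O_L^▷` are the `x ∈ L^×` with `v x ≤ 1` -/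
  emb_mem_intConst_iff : ∀ x : Lˣ, emb x ∈ Z.intConst ↔ v (x : L) ≤ 1
  /-- `emb` intertwines the action of `G` on `Fn` with the Galois action on `L^×` through `res` -/
  actFn_emb : ∀ (g : G) (x : Lˣ), A.actFn g (emb x) = emb (Units.map (res g : L →* L) x)

namespace ConstField

variable {A} {K L : Type v} [Field K] [Field L] [Algebra K L] {Γ₀ : Type w} [LinearOrderedCommGroupWithZero Γ₀]
  (C : A.ConstField K L Γ₀)

/-- A function is constant iff it is `emb x` for some `x ∈ L^×`. [cite: MochizukiEtTh2009, Def 3.1 p.70] -/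
theorem mem_const_iff (f : Z.Fn) : f ∈ Z.const ↔ ∃ x : Lˣ, C.emb x = f := by
  rw [← C.range_emb, MonoidHom.mem_range]

/-- `emb x` is a constant. [cite: MochizukiEtTh2009, Def 3.1 p.70] -/
theorem emb_mem_const (x : Lˣ) : C.emb x ∈ Z.const := (C.mem_const_iff _).2 ⟨x, rfl⟩

/-- The value of `Units.map σ x` is `σ x` (coercion helper). [folklore] -/
private theorem coe_units_map (σ : L ≃ₐ[K] L) (x : Lˣ) : ((Units.map (σ : L →* L) x : Lˣ) : L) = σ (x : L) := rfl

/-- `g · emb x = emb x` iff `res g` fixes `x`. [cite: MochizukiEtTh2009, Def 3.3 p.73] -/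
theorem actFn_emb_eq_iff (g : G) (x : Lˣ) : A.actFn g (C.emb x) = C.emb x ↔ C.res g (x : L) = x := by
  rw [C.actFn_emb, C.emb_injective.eq_iff, Units.ext_iff, coe_units_map]

/-- **`N = Ker(res)`**, elementwise: `g` acts trivially on the constants iff `res g = 1`.
[cite: MochizukiEtTh2009, Def 3.3 p.73] -/
theorem mem_constInertia_iff (g : G) : g ∈ A.constInertia ↔ C.res g = 1 := by
  rw [GaloisAction.mem_constInertia_iff]
  constructor
  · intro h
    ext y
    by_cases hy : y = 0
    · rw [hy, map_zero, AlgEquiv.one_apply]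
    · rw [AlgEquiv.one_apply]
      exact (C.actFn_emb_eq_iff g (Units.mk0 y hy)).1 (h _ (C.emb_mem_const _))
  · intro h f hf
    obtain ⟨x, rfl⟩ := (C.mem_const_iff f).1 hf
    rw [C.actFn_emb_eq_iff, h, AlgEquiv.one_apply]

/-- **`N := Ker(G → Aut(L^×)) = Ker(G ↠ Aut(L/K))`** (`Aut(L/K)` acts faithfully on `L^×`).
[cite: MochizukiEtTh2009, Def 3.3 p.73] -/
theorem constInertia_eq_ker : A.constInertia = C.res.ker :=
  Subgroup.ext fun g => by rw [C.mem_constInertia_iff, MonoidHom.mem_ker]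

/-- The valuation ring of the constant field is stable under `Aut(L/K)` (because `intConst` is `G`-stable and
`res` is onto) — as it must be for the unique extension to `L` of the valuation of `K`.
[cite: MochizukiEtTh2009, Def 3.1 p.70] -/
theorem valuation_le_one_iff_of_res (σ : L ≃ₐ[K] L) (x : Lˣ) : C.v (σ (x : L)) ≤ 1 ↔ C.v (x : L) ≤ 1 := by
  have key : ∀ (τ : L ≃ₐ[K] L) (y : Lˣ), C.v (y : L) ≤ 1 → C.v (τ (y : L)) ≤ 1 := by
    intro τ y hy
    obtain ⟨g, rfl⟩ := C.res_surjective τ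
    have h := A.act_mem_intConst g ((C.emb_mem_intConst_iff y).2 hy)
    rw [C.actFn_emb, C.emb_mem_intConst_iff, coe_units_map] at h
    exact h
  refine ⟨fun h => ?_, key σ x⟩
  have h' := key σ⁻¹ (Units.map (σ : L →* L) x) h
  rwa [coe_units_map, ← AlgEquiv.mul_apply, inv_mul_cancel, AlgEquiv.one_apply] at h'

/-- A unit of the valuation ring (`v x = 1`) gives a UNIT integral constant: `emb x ∈ intConst` and
`(emb x)⁻¹ ∈ intConst`. [cite: MochizukiEtTh2009, Prop 3.4 p.74] -/
theorem emb_mem_intConst_and_inv_mem (x : Lˣ) (hx : C.v (x : L) = 1) :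
    C.emb x ∈ Z.intConst ∧ (C.emb x)⁻¹ ∈ Z.intConst := by
  refine ⟨(C.emb_mem_intConst_iff x).2 hx.le, ?_⟩
  rw [← map_inv, C.emb_mem_intConst_iff, Units.val_inv_eq_inv_val, map_inv₀, hx, inv_one]

/-- Conversely a unit integral constant `emb x` has `v x = 1` ("`O_L^× ⥲ Ker(B₀ → Φ₀^gp)`", Prop. 3.4 (ii)).
[cite: MochizukiEtTh2009, Prop 3.4 p.74] -/
theorem valuation_eq_one_of_mem_intConst (x : Lˣ) (hx : C.emb x ∈ Z.intConst) (hx' : (C.emb x)⁻¹ ∈ Z.intConst) :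
    C.v (x : L) = 1 := by
  refine le_antisymm ((C.emb_mem_intConst_iff x).1 hx) ?_
  rw [← map_inv, C.emb_mem_intConst_iff, Units.val_inv_eq_inv_val, map_inv₀] at hx'
  have hx0 : 0 < C.v (x : L) := zero_lt_iff.2 ((Valuation.ne_zero_iff _).2 x.ne_zero)
  exact (inv_le_one₀ hx0).1 hx'

/-- The hypothesis of the binder, unfolded through the constant field: if `a` fixes every `H`-invariant UNIT
integral constant, then `res a` fixes every element of valuation `1` of the fixed field of `res(H)`.
[cite: MochizukiEtTh2009, Thm 3.7 (iii) p.79] -/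
theorem res_apply_eq_of_valuation_eq_one (H : Subgroup G) (a : G)
    (ha : ∀ u : Z.Fn, u ∈ Z.intConst → u⁻¹ ∈ Z.intConst → (∀ h ∈ H, A.actFn h u = u) → A.actFn a u = u)
    (y : L) (hyF : y ∈ IntermediateField.fixedField (H.map C.res)) (hy : C.v y = 1) : C.res a y = y := by
  have hy0 : y ≠ 0 := fun h => by rw [h, map_zero] at hy; exact zero_ne_one hy
  obtain ⟨hint, hint'⟩ := C.emb_mem_intConst_and_inv_mem (Units.mk0 y hy0) hy
  have hH : ∀ h ∈ H, A.actFn h (C.emb (Units.mk0 y hy0)) = C.emb (Units.mk0 y hy0) := fun h hh =>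
    (C.actFn_emb_eq_iff h _).2 ((IntermediateField.mem_fixedField_iff (H.map C.res) y).1 hyF (C.res h)
      (Subgroup.mem_map_of_mem C.res hh))
  exact (C.actFn_emb_eq_iff a (Units.mk0 y hy0)).1 (ha _ hint hint' hH)

/-- Step 1 of the law: under the hypothesis of the binder, `res a` fixes the WHOLE fixed field `F = L^{res(H)}`
— because the units of the valuation ring of `F` generate `F` (abc-iut-L6-t8's
`ringHom_eq_of_eqOn_valuation_eq_one`; Thm. 3.7 (iii) "`Aut` acts faithfully on `O^×`").
[cite: MochizukiEtTh2009, Thm 3.7 (iii) p.79] -/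
theorem res_mem_fixingSubgroup_fixedField (H : Subgroup G) (a : G)
    (ha : ∀ u : Z.Fn, u ∈ Z.intConst → u⁻¹ ∈ Z.intConst → (∀ h ∈ H, A.actFn h u = u) → A.actFn a u = u) :
    C.res a ∈ IntermediateField.fixingSubgroup (IntermediateField.fixedField (H.map C.res)) := by
  rw [IntermediateField.mem_fixingSubgroup_iff]
  intro y hyF
  -- the valuation of `L` restricted to the intermediate field `F`
  let F : IntermediateField K L := IntermediateField.fixedField (H.map C.res)
  have key := Literature.NumberTheory.LocalFields.ringHom_eq_of_eqOn_valuation_eq_one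
    (C.v.comap (algebraMap F L)) (((C.res a : L ≃ₐ[K] L) : L →+* L).comp (algebraMap F L)) (algebraMap F L)
    fun z hz => C.res_apply_eq_of_valuation_eq_one H a ha (z : L) z.2 hz
  exact RingHom.congr_fun key ⟨y, hyF⟩

/-- **The Galois-correspondence law for the constants is a THEOREM at every datum with a constant field**
(GAP G-w6d058-2 discharged there): an element of `G` fixing every `H`-invariant unit integral constant lies in
`N·H`.  Step 1: it fixes `F = L^{res(H)}` (`res_mem_fixingSubgroup_fixedField`); step 2: the Galois
correspondence `Fix(L^{H'}) = H'` for the finite extension `L/K` puts `res a` in `res(H)`, i.e. `a ∈ N·H`.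
[cite: MochizukiEtTh2009, Thm 3.7 (iii) p.79] -/
theorem constGaloisLaw (C : A.ConstField K L Γ₀) : A.ConstGaloisLaw := by
  haveI := C.finiteDimensional
  refine ⟨fun H a ha => ?_⟩
  have hmem : C.res a ∈ H.map C.res := by
    rw [← IntermediateField.fixingSubgroup_fixedField (H.map C.res)]
    exact C.res_mem_fixingSubgroup_fixedField H a ha
  obtain ⟨h, hh, hha⟩ := Subgroup.mem_map.1 hmem
  refine ⟨a * h⁻¹, ?_, ?_⟩
  · rw [C.mem_constInertia_iff, map_mul, map_inv, hha, mul_inv_cancel]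
  · rw [mul_inv_rev, inv_inv, inv_mul_cancel_right]
    exact hh

/-- The law in the form the dischargers consume: `Nonempty (ConstField …) → ConstGaloisLaw`.
[cite: MochizukiEtTh2009, Thm 3.7 (iii) p.79] -/
theorem _root_.Literature.AnabelianGeometry.EtaleTheta.LogDivisorModel.GaloisAction.constGaloisLaw_of_nonempty_constField
    (h : Nonempty (A.ConstField K L Γ₀)) : A.ConstGaloisLaw :=
  h.elim fun C => C.constGaloisLaw

end ConstField

end LogDivisorModel.GaloisAction

/-! ## Non-vacuity with a non-trivial Galois action: the constants-only model of a field -/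

namespace LogDivisorModel

/-- **The constants-only log-divisor model of a field `L` with finite unit group** (degenerate: empty special
fibre, no cusps, `DIV = 1`; functions = constants = `L^×`, all integral): every field of the Def. 3.1 /
Prop. 3.2 interface holds, Prop. 3.2 (iii) ("infinitely divisible ⇒ trivial") because `L^×` is finite.  A
consistency witness carrying a GENUINE field of constants, no more. [cite: MochizukiEtTh2009, Def 3.1 p.70] -/
def constOnly (L : Type u) [Field L] [Finite Lˣ] : LogDivisorModel.{u} where
  Fn := Lˣ
  DIV := PUnit
  DIVplus := ⊤
  Div := ⊤
  exists_div_eq _ := ⟨1, trivial, 1, trivial, Subsingleton.elim _ _⟩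
  eq_one_of_mem_of_inv_mem _ _ _ := Subsingleton.elim _ _
  nonCuspidal := ⊤
  cuspidal := ⊥
  nonCuspidal_isCompl_cuspidal := isCompl_top_bot
  logMero := ⊤
  divisor := 1
  divisor_mem_Div _ := trivial
  const := ⊤
  const_le_logMero := le_rfl
  intConst := ⊤
  intConst_le_const := le_rfl
  temperedMero := ⊤
  temperedMero_le_logMero := le_rfl
  exists_pow_mem_Div := ⟨1, fun _ => trivial⟩
  Cusp := PEmpty
  Comp := PEmpty
  divPlusEquiv :=
    { toFun := fun _ _ => 1
      invFun := fun _ => ⟨PUnit.unit, trivial⟩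
      left_inv := fun _ => Subsingleton.elim _ _
      right_inv := fun _ => funext fun x => Sum.elim PEmpty.elim PEmpty.elim x
      map_mul' := fun _ _ => funext fun x => Sum.elim PEmpty.elim PEmpty.elim x }
  divPlusEquiv_nonCuspidal _ := ⟨fun _ c => c.elim, fun _ => trivial⟩
  mem_intConst_of_divisor_mem _ _ := trivial
  divisor_mem_of_mem_intConst _ _ := ⟨trivial, trivial⟩
  divisor_eq_one_iff _ := ⟨fun _ => ⟨trivial, trivial⟩, fun _ => Subsingleton.elim _ _⟩
  eq_one_of_forall_exists_pow_eq f hf := by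
    obtain ⟨g, hg⟩ := hf ⟨Nat.card Lˣ, Nat.card_pos⟩
    rw [← hg]
    exact pow_card_eq_one'

/-- **`Aut(L/K)` acting on the constants-only model** through its action on `L^×` (all `GaloisAction` laws
hold; nothing else to act on). [cite: MochizukiEtTh2009, Def 3.3 p.73] -/
def constOnlyAction (K L : Type u) [Field K] [Field L] [Algebra K L] [Finite Lˣ] :
    (constOnly L).GaloisAction (L ≃ₐ[K] L) where
  actFn :=
    { toFun := fun σ => Units.mapEquiv (σ : L ≃ₐ[K] L).toRingEquiv.toMulEquiv
      map_one' := MulEquiv.ext fun _ => Units.ext rfl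
      map_mul' := fun _ _ => MulEquiv.ext fun _ => Units.ext rfl }
  actDIV := 1
  permCusp := 1
  permComp := 1
  act_mem_DIVplus _ _ _ := trivial
  act_mem_Div _ _ _ := trivial
  act_mem_logMero _ _ _ := trivial
  act_mem_const _ _ _ := trivial
  act_mem_intConst _ _ _ := trivial
  divisor_act _ _ := rfl
  mult_act _ _ x := Sum.elim (fun c => c.elim) (fun c => c.elim) x

/-- `Aut(L/K)` acts on the functions `L^×` of the constants-only model through `σ` on values.
[cite: MochizukiEtTh2009, Def 3.3 p.73] -/
theorem constOnlyAction_actFn_apply (K L : Type u) [Field K] [Field L] [Algebra K L] [Finite Lˣ]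
    (σ : L ≃ₐ[K] L) (x : Lˣ) : (constOnlyAction K L).actFn σ x = Units.map (σ : L →* L) x := Units.ext rfl

/-- **The constant-field structure is inhabited, with a non-trivial Galois action**: on the constants-only
model of a finite extension `L/K` with `L^×` finite (e.g. `𝔽_4/𝔽_2` with its Frobenius), with the trivial
valuation, `res = id`, `emb = id`. [cite: MochizukiEtTh2009, Def 3.3 p.73] -/
noncomputable def GaloisAction.ConstField.ofConstOnly (K L : Type u) [Field K] [Field L] [Algebra K L]
    [Finite Lˣ] [FiniteDimensional K L] [DecidableEq L] (Γ₀ : Type w) [LinearOrderedCommGroupWithZero Γ₀] :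
    (constOnlyAction K L).ConstField K L Γ₀ where
  v := 1
  finiteDimensional := ‹_›
  res := MonoidHom.id _
  res_surjective := Function.surjective_id
  emb := MonoidHom.id _
  emb_injective := Function.injective_id
  range_emb := MonoidHom.range_eq_top.2 Function.surjective_id
  emb_mem_intConst_iff x := ⟨fun _ => Valuation.one_apply_le_one _, fun _ => Submonoid.mem_top _⟩
  actFn_emb _ _ := Units.ext rfl

/-- Hence the structure `ConstField` is non-vacuous at a non-trivial action. [cite: MochizukiEtTh2009, Def 3.3 p.73] -/
theorem GaloisAction.nonempty_constField (K L : Type u) [Field K] [Field L] [Algebra K L] [Finite Lˣ]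
    [FiniteDimensional K L] [DecidableEq L] (Γ₀ : Type w) [LinearOrderedCommGroupWithZero Γ₀] :
    Nonempty ((constOnlyAction K L).ConstField K L Γ₀) :=
  ⟨GaloisAction.ConstField.ofConstOnly K L Γ₀⟩

/-- … and there the law has CONTENT: `N = 1` and `constGaloisLaw` IS the Galois correspondence for `L/K`
(an automorphism fixing every `H`-invariant nonzero element lies in `H`). [cite: MochizukiEtTh2009, Thm 3.7 (iii) p.79] -/
theorem GaloisAction.constGaloisLaw_constOnlyAction (K L : Type u) [Field K] [Field L] [Algebra K L] [Finite Lˣ]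
    [FiniteDimensional K L] : (constOnlyAction K L).ConstGaloisLaw := by
  classical
  exact (GaloisAction.ConstField.ofConstOnly K L (WithZero (Multiplicative ℤ))).constGaloisLaw

/-- In the constants-only model `N = 1`: only the identity of `Aut(L/K)` acts trivially on `L^×`.
[cite: MochizukiEtTh2009, Def 3.3 p.73] -/
theorem GaloisAction.constInertia_constOnlyAction (K L : Type u) [Field K] [Field L] [Algebra K L] [Finite Lˣ]
    [FiniteDimensional K L] : (constOnlyAction K L).constInertia = ⊥ := by
  classical
  rw [(GaloisAction.ConstField.ofConstOnly K L (WithZero (Multiplicative ℤ))).constInertia_eq_ker]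
  exact (MonoidHom.ker_eq_bot_iff _).2 Function.injective_id

end LogDivisorModel

end Literature.AnabelianGeometry.EtaleTheta
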